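/-
Copyright: statement-level skeleton of a published paper (lit-balaban cell, Phase-2 proof seat p18, gen 7). No claims beyond
what the kernel checks below.
-/
import Mathlib
import Literature.MathematicalPhysics.QuantumFieldTheory.Balaban1983to89.B3FreeLineIBP
import Literature.MathematicalPhysics.QuantumFieldTheory.Balaban1983to89.B3AmpIBPSingle

/-!
# B3 — T. Bałaban, *(Higgs)₂,₃ quantum fields in a finite volume. III. Renormalization*, CMP **88** (1983) 411–445
[Balaban1983Higgs3] — Proposition 2.2 p. 428 with the (2.4) exception: the IBP-ready amplitudes over the generalized graphs
with free line exponents AT THE PRINT'S STRENGTH (one derivative leg per vertex; the derivative budget only where (2.8) can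
put a difference), their terms `G′∗`, and the κ ≡ 0 bridge from the standard graphs

statement-level skeleton of published theorems with citation tags; proofs where landed; nothing here is a claim about
the Yang–Mills mass gap

PDF held: `paper:balaban1983-higgs-2-3-quantum-fields-finite-volume` (journal page = PDF page + 410).

Part of the Phase-2 work on SKELETON row **B3.Prop2.2** (unit `lit-balaban-p18` gen 7, HOME `run/shared/lean/pub/lit-balaban/`;
the fold owner's closing item «free line exponent κ_l», landed as `B3Prop22FreeLines.prop22_freeLines`): files
`B3FreeLineSingle` (this file) → `B3Prop22FreeLinesSingle` (`prop22_freeLines₁`), the print-strength companions of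
`B3FreeLineAmplitude`/`B3FreeLineIBP`/`B3Prop22FreeLines`, following seat p19 gen 5's `B3AmpIBPSingle` (the κ ≡ 0 twin
`IBPAmp₁`, whose conditional kernel budget `KBudgetC` is reused by name) line by line.

WHAT IS REPRODUCED.  p. 425 [PDF 15], (2.8): the ONE derivative leg `(D^η_B̃φ′)(b)` of the vertex (1.8) p. 413 is moved
onto the other factors at the vertex, each undifferentiated there; p. 426 [PDF 16]: *"if the propagator is differentiated,
then for each differentiation, there is an additional factor (L^jη)^{−1} on the right side"*; p. 428 [PDF 18]: *"The only
thing which matters is that propagators have representations corresponding to (2.6) with the estimates corresponding to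
(2.10)–(2.12) … Proposition 2.2. Proposition 2.1 holds for the described above generalized expressions and graphs."*  The
class `IBPAmpK` of `B3FreeLineAmplitude` (like p19 gen 4's `IBPAmp`) demanded the derivative budget for a second difference
in an argument already differentiated, which (2.8) never produces and Propositions I.2.1/I.2.3 do not state.  KERNEL-CHECKED
HERE: the print-strength class **`IBPAmpK₁ G κ`** over the generalized graph `Counts.toModelK G κ` — (i) `single`: a vertex
has at most one derivative leg (as (1.6)–(1.15)); (ii) the budget `KdX_le`/`KdY_le`/`KdXY_le` only for lines undifferentiated
at the corresponding endpoint — with: the stronger class maps into it (`IBPAmpK.toSingle`); every term `G′∗_c` is again an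
amplitude of the class `Amp` over `(moveCounts G S c).toModelK κ` (**`IBPAmpK₁.term`**, `term_K_le` through p19 gen 5's
`KBudgetC.apCode_bound`: a line hit in a variable was undifferentiated there, `diffOn_src_eq_zero_of_xcode₁`), `E(G′(j)) =
Σ_c E(G′∗_c(j))` (`E_eq_sum_terms`), `prefM(G′∗_c) ≤ cD^m·prefM`, `ΠC(G′∗_c) = (ΠC)(1+e^{δ₁})^{2m}`, the readiness kept under
relabeling (`relabel`), non-vacuity (`zero`); and **the κ ≡ 0 bridge `IBPAmp₁.toK₁`**: every print-strength IBP-ready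
amplitude over a count datum with the standard line dimensions (p19 gen 5's `IBPAmp₁ G`, e.g. the zero-field box amplitudes
of `B3IBPZeroBox`) IS one over the generalized graph with `κ ≡ 0`.  HONEST SCOPE: the analytic inputs remain hypotheses
(fields) of the class, at exactly the strength the printed derivation uses.
-/

open Finset

namespace Literature.MathematicalPhysics.QuantumFieldTheory.Balaban1983to89

namespace B3Ineq213

open B3Ineq215 B3FreeLine

variable {V : Type} [Fintype V] [DecidableEq V] {m : ℕ}

/-! ## The print-strength IBP-ready class over the generalized graphs -/

section Ready

/-- **An IBP-READY localized lattice graph amplitude, print's strength, over the generalized graph `Counts.toModelK G κ`**: an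
amplitude of the class `Amp` with a bond direction per vertex; every vertex has AT MOST ONE derivative leg (`single`); for
every differentiated line `l` with two endpoints the undifferentiated kernel `K♭_l`, `K_l = ∂⁺_{dir s(l)} K♭_l` in the first
variable, obeying (2.10) with the dimension `a_l + 1`, and the vertex function at `s(l)` vanishing on the `dir s(l)`-faces of
`□(s(l))` with `|∂⁻ u_{s(l)}| ≤ cD ×` the vertex bound; and the derivative budget (2.10) of a kernel in a variable ONLY IF the line
is undifferentiated at that endpoint. [cite: Balaban1983Higgs3, (2.8) p.425] -/
structure IBPAmpK₁ (G : Counts V m) (κ : Fin m → ℚ) extends Amp (G.toModelK κ) where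
  /-- the bond direction of the derivative leg at each vertex -/
  dir : V → Fin (G.toModelK κ).d
  /-- the undifferentiated kernels `K♭_l` -/
  Kb : Fin m → Ker (G.toModelK κ).d
  /-- the constant of the differentiated vertex bound -/
  cD : ℝ
  one_le_cD : 1 ≤ cD
  /-- at most one derivative leg per vertex -/
  single : ∀ (v : V) (l l' : Fin m), l ≠ l' → 1 ≤ G.diffOn v l → G.diffOn v l' = 0
  /-- `K_l = ∂⁺_{dir s(l)} K♭_l` in the first variable, on every differentiated line with two endpoints -/
  K_eq : ∀ l, G.src l ≠ G.tgt l → 1 ≤ G.diffOn (G.src l) l → ∀ t x y,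
    K l t x y = fdiffQ (((G.toModelK κ).L : ℝ) ^ k) (dir (G.src l)) (fun x' => Kb l t x' y) x
  /-- (2.10) for `K♭_l` with the dimension `a_l + 1` -/
  Kb_le : ∀ l, G.src l ≠ G.tgt l → 1 ≤ G.diffOn (G.src l) l →
    KBd (G.toModelK κ) k (C l) ((G.toModelK κ).a l + 1) (Kb l)
  /-- the vertex function at `s(l)` vanishes on the two `dir s(l)`-faces of its cube -/
  u_face : ∀ l, G.src l ≠ G.tgt l → 1 ≤ G.diffOn (G.src l) l →
    FaceVanishing (G.toModelK κ).L (⟨k, box (G.src l)⟩ : Cube (G.toModelK κ).d) (dir (G.src l)) (u (G.src l))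
  /-- the differentiated vertex bound -/
  du_le : ∀ l, G.src l ≠ G.tgt l → 1 ≤ G.diffOn (G.src l) l → ∀ x,
    |bdiffQ (((G.toModelK κ).L : ℝ) ^ k) (dir (G.src l)) (u (G.src l)) x|
      ≤ cD * (eRun ^ dv (G.src l) * lamRun ^ ds (G.src l) * NPhi (G.src l) * NA (G.src l)
        * ((((G.toModelK κ).L : ℝ) ^ k)⁻¹) ^ (G.toModelK κ).e (G.src l))
  /-- (2.10) with one more difference quotient in the first variable — for lines undifferentiated at their first endpoint -/
  KdX_le : ∀ l μ, G.diffOn (G.src l) l = 0 →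
    KBd (G.toModelK κ) k (C l) ((G.toModelK κ).a l - 1) (dK (((G.toModelK κ).L : ℝ) ^ k) μ true false (K l))
  /-- (2.10) with one more difference quotient in the second variable — for lines undifferentiated at their second endpoint -/
  KdY_le : ∀ l ν, G.diffOn (G.tgt l) l = 0 →
    KBd (G.toModelK κ) k (C l) ((G.toModelK κ).a l - 1) (dK (((G.toModelK κ).L : ℝ) ^ k) ν false true (K l))
  /-- (2.10) with one more difference quotient in each variable — for lines undifferentiated at both endpoints -/
  KdXY_le : ∀ l μ ν, G.diffOn (G.src l) l = 0 → G.diffOn (G.tgt l) l = 0 →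
    KBd (G.toModelK κ) k (C l) ((G.toModelK κ).a l - 2)
      (dK (((G.toModelK κ).L : ℝ) ^ k) μ true false (dK (((G.toModelK κ).L : ℝ) ^ k) ν false true (K l)))

/-- The stronger readiness of `IBPAmpK` implies the print-strength readiness, given one derivative leg per vertex.
[cite: Balaban1983Higgs3, (2.8) p.425] -/
noncomputable def IBPAmpK.toSingle {G : Counts V m} {κ : Fin m → ℚ} (A : IBPAmpK G κ)
    (hs : ∀ (v : V) (l l' : Fin m), l ≠ l' → 1 ≤ G.diffOn v l → G.diffOn v l' = 0) : IBPAmpK₁ G κ where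
  toAmp := A.toAmp
  dir := A.dir
  Kb := A.Kb
  cD := A.cD
  one_le_cD := A.one_le_cD
  single := hs
  K_eq := A.K_eq
  Kb_le := A.Kb_le
  u_face := A.u_face
  du_le := A.du_le
  KdX_le := fun l μ _ => A.KdX_le l μ
  KdY_le := fun l ν _ => A.KdY_le l ν
  KdXY_le := fun l μ ν _ _ => A.KdXY_le l μ ν

/-! ## The κ ≡ 0 bridge from the standard graphs -/

/-- **Every print-strength IBP-ready amplitude over a count datum with the standard line dimensions (p19's `IBPAmp₁ G`) is one
over the generalized graph with no extra exponents** (`κ ≡ 0`; the line dimensions `lineDim l + 0`). [cite: Balaban1983Higgs3, Prop. 2.2 p.428] -/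
noncomputable def IBPAmp₁.toK₁ {G : Counts V m} (A : IBPAmp₁ G) : IBPAmpK₁ G (fun _ => 0) where
  k := A.k
  box := A.box
  u := A.u
  K := A.K
  C := A.C
  eRun := A.eRun
  lamRun := A.lamRun
  dv := A.dv
  ds := A.ds
  NPhi := A.NPhi
  NA := A.NA
  C_nonneg := A.C_nonneg
  eRun_nonneg := A.eRun_nonneg
  lamRun_nonneg := A.lamRun_nonneg
  NPhi_nonneg := A.NPhi_nonneg
  NA_nonneg := A.NA_nonneg
  e_nonneg := A.e_nonneg
  conn := A.conn
  u_le := A.u_le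
  K_le := fun l t ht x x' => by
    rw [toModelK_a, Rat.cast_zero, add_zero]
    exact A.K_le l t ht x x'
  dir := A.dir
  Kb := A.Kb
  cD := A.cD
  one_le_cD := A.one_le_cD
  single := A.single
  K_eq := A.K_eq
  Kb_le := fun l hne hd => by
    rw [toModelK_a, Rat.cast_zero, add_zero]
    exact A.Kb_le l hne hd
  u_face := A.u_face
  du_le := A.du_le
  KdX_le := fun l μ h => by
    rw [toModelK_a, Rat.cast_zero, add_zero]
    exact A.KdX_le l μ h
  KdY_le := fun l ν h => by
    rw [toModelK_a, Rat.cast_zero, add_zero]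
    exact A.KdY_le l ν h
  KdXY_le := fun l μ ν hx hy => by
    rw [toModelK_a, Rat.cast_zero, add_zero]
    exact A.KdXY_le l μ ν hx hy

/-- The bridge keeps the amplitude. [cite: Balaban1983Higgs3, Prop. 2.2 p.428] -/
theorem IBPAmp₁.toK₁_E {G : Counts V m} (A : IBPAmp₁ G) (j : Fin m → ℕ) : A.toK₁.E j = A.E j := rfl

/-- The bridge keeps the total amplitude. [cite: Balaban1983Higgs3, (2.6) p.424] -/
theorem IBPAmp₁.toK₁_EtotM {G : Counts V m} (A : IBPAmp₁ G) : A.toK₁.toAmp.EtotM = A.toAmp.Etot := rfl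

/-- The bridge keeps the prefactor. [cite: Balaban1983Higgs3, (1.33) p.420] -/
theorem IBPAmp₁.toK₁_prefM {G : Counts V m} (A : IBPAmp₁ G) : A.toK₁.toAmp.prefM = A.toAmp.pref := rfl

namespace IBPAmpK₁

variable {G : Counts V m} {κ : Fin m → ℚ}

/-- The conditional derivative budget of each kernel (p19 gen 5's `KBudgetC`). [cite: Balaban1983Higgs3, (2.10) p.426] -/
theorem budgetC (A : IBPAmpK₁ G κ) (l : Fin m) : KBudgetC (G.toModelK κ) A.k (A.C l) ((G.toModelK κ).a l)
    (G.diffOn (G.src l) l = 0) (G.diffOn (G.tgt l) l = 0) (A.K l) :=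
  ⟨A.K_le l, fun h μ => A.KdX_le l μ h, fun h ν => A.KdY_le l ν h, fun hx hy μ ν => A.KdXY_le l μ ν hx hy⟩

/-! ## Where (2.8) puts a difference, the line was undifferentiated -/

variable {S : Finset (Fin m)} {c : Fin m → Option (Fin m)}

/-- **A line hit in its first variable was undifferentiated at its first endpoint** (one derivative leg per vertex).
[cite: Balaban1983Higgs3, (2.8) p.425] -/
theorem diffOn_src_eq_zero_of_xcode₁ (A : IBPAmpK₁ G κ) (hS : S ⊆ sites G) {q : Fin m} (hx : xcode G.src S c q = 2) :
    G.diffOn (G.src q) q = 0 := by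
  obtain ⟨l, hl, hlq, hsrc, -⟩ := (xcode_eq_two_iff G S c q).1 hx
  have h1 : 1 ≤ G.diffOn (G.src l) l := (mem_sites.1 (hS hl)).2.1
  rw [← hsrc]
  exact A.single (G.src l) l q hlq h1

/-- **A line hit in its second variable was undifferentiated at its second endpoint.** [cite: Balaban1983Higgs3, (2.8) p.425] -/
theorem diffOn_tgt_eq_zero_of_ycode₁ (A : IBPAmpK₁ G κ) (hS : S ⊆ sites G) {q : Fin m} (hy : ycode G.src G.tgt S c q = 2) :
    G.diffOn (G.tgt q) q = 0 := by
  obtain ⟨l, hl, hlq, hsrc, -⟩ := (ycode_eq_two_iff G S c q).1 hy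
  have h1 : 1 ≤ G.diffOn (G.src l) l := (mem_sites.1 (hS hl)).2.1
  rw [← hsrc]
  exact A.single (G.src l) l q hlq h1

/-! ## The terms `G′∗_c` are amplitudes of the class `Amp` -/

/-- The vertex-field norms of the term: a factor `cD` where the vertex function was differentiated. [cite: Balaban1983Higgs3, (2.9) p.425] -/
noncomputable def NAc (A : IBPAmpK₁ G κ) (S : Finset (Fin m)) (c : Fin m → Option (Fin m)) (v : V) : ℝ :=
  if (∃ l ∈ S, G.src l = v ∧ c l = none) then A.cD * A.NA v else A.NA v

/-- **The kernels of the term `c` obey (2.10) with the moved generalized dimensions** and the constants `C_l (1 + e^{2δ₀})²` — from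
the print-strength budget. [cite: Balaban1983Higgs3, (2.10) p.426] -/
theorem term_K_le (A : IBPAmpK₁ G κ) (hS : S ⊆ sites G) (hc : c ∈ choices G.src G.tgt S) (q : Fin m) :
    KBd (G.toModelK κ) A.k (A.C q * (1 + Esh (G.toModelK κ)) ^ 2) (((moveCounts G S c).toModelK κ).a q)
      (allK G.src G.tgt A.dir (((G.toModelK κ).L : ℝ) ^ A.k) A.Kb S c A.K q) := by
  have hS1 : ∀ l ∈ S, 1 ≤ G.diffOn (G.src l) l := fun l hl => (mem_sites.1 (hS hl)).2.1
  have hE := one_le_Esh (G.toModelK κ)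
  have hCq : 0 ≤ A.C q := A.C_nonneg q
  have hC1 : A.C q ≤ A.C q * (1 + Esh (G.toModelK κ)) ^ 2 :=
    le_mul_of_one_le_right hCq (one_le_pow₀ (by linarith))
  rw [toModelK_a_moveCounts G κ hS1 c q]
  by_cases hq : q ∈ S
  · -- a site line: `K♭`, dimension `a + κ + 1`
    have hsite := mem_sites.1 (hS hq)
    rw [if_pos hq, IBPAmp.nHit_of_mem hS hc hq, Nat.cast_zero, sub_zero]
    have hK : allK G.src G.tgt A.dir (((G.toModelK κ).L : ℝ) ^ A.k) A.Kb S c A.K q = A.Kb q := by simp [allK, hq]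
    rw [hK]
    exact (A.Kb_le q hsite.1 hsite.2.1).mono hC1
  · rw [if_neg hq, add_zero, nHit_eq_codes G ((sites_isSiteSet G).mono hS) hc q]
    unfold allK
    rw [if_neg hq]
    have hpx : xcode G.src S c q = 2 → G.diffOn (G.src q) q = 0 := fun h => A.diffOn_src_eq_zero_of_xcode₁ hS h
    have hpy : ycode G.src G.tgt S c q = 2 → G.diffOn (G.tgt q) q = 0 := fun h => A.diffOn_tgt_eq_zero_of_ycode₁ hS h
    by_cases hloop : G.src q = G.tgt q
    · have hexp : ((if xcode G.src S c q = 2 then 1 else 0)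
          + (if G.src q ≠ G.tgt q ∧ ycode G.src G.tgt S c q = 2 then 1 else 0) : ℕ) = nd (xcode G.src S c q) := by
        rw [if_neg (show ¬ (G.src q ≠ G.tgt q ∧ ycode G.src G.tgt S c q = 2) from fun h => h.1 hloop), add_zero]
        rfl
      rw [if_pos hloop, hexp]
      have hpy' : xcode G.src S c q = 2 → G.diffOn (G.tgt q) q = 0 := fun h => hloop ▸ hpx h
      exact (A.budgetC q).apCode_bound_loop hCq (IBPAmp.xcode_le_two q) hpx hpy' _
    · rw [if_neg hloop]
      have h := (A.budgetC q).apCode_bound hCq (IBPAmp.xcode_le_two (G := G) (S := S) (c := c) q)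
        (IBPAmp.ycode_le_two (G := G) (S := S) (c := c) q) hpx hpy (A.dir (G.src q)) (A.dir (G.tgt q))
      simp only [nd, ne_eq, hloop, not_false_eq_true, true_and] at h ⊢
      exact h

/-- **The vertex functions of the term `c` obey the vertex bound** (`× cD` where differentiated).
[cite: Balaban1983Higgs3, (2.9) p.425] -/
theorem term_u_le (A : IBPAmpK₁ G κ) (hS : S ⊆ sites G) (v : V) (x : Fin (G.toModelK κ).d → ℕ) :
    |allU G.src A.dir (((G.toModelK κ).L : ℝ) ^ A.k) S c A.u v x|
      ≤ A.eRun ^ A.dv v * A.lamRun ^ A.ds v * A.NPhi v * A.NAc S c v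
        * ((((G.toModelK κ).L : ℝ) ^ A.k)⁻¹) ^ ((moveCounts G S c).toModelK κ).e v := by
  have he : ((moveCounts G S c).toModelK κ).e v = (G.toModelK κ).e v := rfl
  rw [he]
  unfold allU NAc
  by_cases h1 : ∃ l ∈ S, G.src l = v
  · rw [if_pos h1]
    obtain ⟨l, hl, hlv⟩ := h1
    have hsite := mem_sites.1 (hS hl)
    by_cases h2 : ∃ l ∈ S, G.src l = v ∧ c l = none
    · rw [if_pos h2, if_pos h2, abs_neg, ← hlv]
      calc |bdiffQ (((G.toModelK κ).L : ℝ) ^ A.k) (A.dir (G.src l)) (A.u (G.src l)) x|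
          ≤ A.cD * (A.eRun ^ A.dv (G.src l) * A.lamRun ^ A.ds (G.src l) * A.NPhi (G.src l) * A.NA (G.src l)
              * ((((G.toModelK κ).L : ℝ) ^ A.k)⁻¹) ^ (G.toModelK κ).e (G.src l)) := A.du_le l hsite.1 hsite.2.1 x
        _ = _ := by ring
    · rw [if_neg h2, if_neg h2, abs_neg]
      exact A.u_le v _
  · have h2 : ¬ ∃ l ∈ S, G.src l = v ∧ c l = none := fun ⟨l, hl, hv, _⟩ => h1 ⟨l, hl, hv⟩
    rw [if_neg h1, if_neg h2]
    exact A.u_le v x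

/-- **The term `G′∗_c` as an amplitude of the class `Amp` over the generalized graph of the moved count datum**, from the
print-strength readiness. [cite: Balaban1983Higgs3, (2.9) p.425] -/
noncomputable def term (A : IBPAmpK₁ G κ) (hS : S ⊆ sites G) (hc : c ∈ choices G.src G.tgt S) :
    Amp ((moveCounts G S c).toModelK κ) where
  k := A.k
  box := A.box
  u := allU G.src A.dir (((G.toModelK κ).L : ℝ) ^ A.k) S c A.u
  K := allK G.src G.tgt A.dir (((G.toModelK κ).L : ℝ) ^ A.k) A.Kb S c A.K
  C := fun q => A.C q * (1 + Esh (G.toModelK κ)) ^ 2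
  eRun := A.eRun
  lamRun := A.lamRun
  dv := A.dv
  ds := A.ds
  NPhi := A.NPhi
  NA := A.NAc S c
  C_nonneg := fun q => mul_nonneg (A.C_nonneg q) (sq_nonneg _)
  eRun_nonneg := A.eRun_nonneg
  lamRun_nonneg := A.lamRun_nonneg
  NPhi_nonneg := A.NPhi_nonneg
  NA_nonneg := fun v => by
    unfold NAc
    split_ifs
    · exact mul_nonneg (le_trans zero_le_one A.one_le_cD) (A.NA_nonneg v)
    · exact A.NA_nonneg v
  e_nonneg := A.e_nonneg
  conn := A.conn
  u_le := A.term_u_le hS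
  K_le := fun q => A.term_K_le hS hc q

/-- The amplitude of the term at `j` is the raw sum of its closed-form data. [cite: Balaban1983Higgs3, (2.9) p.425] -/
theorem term_E (A : IBPAmpK₁ G κ) (hS : S ⊆ sites G) (hc : c ∈ choices G.src G.tgt S) (j : Fin m → ℕ) : (A.term hS hc).E j
    = rawE (G.toModelK κ).L (G.toModelK κ).d A.k G.src G.tgt A.box
        (allU G.src A.dir (((G.toModelK κ).L : ℝ) ^ A.k) S c A.u)
        (allK G.src G.tgt A.dir (((G.toModelK κ).L : ℝ) ^ A.k) A.Kb S c A.K) j := rfl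

/-- **`E(G′(j)) = Σ_c E(G′∗_c(j))`** over the generalized graph, print-strength readiness. [cite: Balaban1983Higgs3, (2.9) p.425] -/
theorem E_eq_sum_terms (A : IBPAmpK₁ G κ) (hS : S ⊆ sites G) (j : Fin m → ℕ) :
    (A.toAmp : Amp (G.toModelK κ)).E j
      = ∑ c ∈ (choices G.src G.tgt S).attach, (A.term hS c.2 : Amp ((moveCounts G S c.1).toModelK κ)).E j := by
  have hS1 := fun l (hl : l ∈ S) => mem_sites.1 (hS hl)
  have hsum : ∑ c ∈ (choices G.src G.tgt S).attach, (A.term hS c.2).E j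
      = ∑ c ∈ choices G.src G.tgt S, rawE (G.toModelK κ).L (G.toModelK κ).d A.k G.src G.tgt A.box
          (allU G.src A.dir (((G.toModelK κ).L : ℝ) ^ A.k) S c A.u)
          (allK G.src G.tgt A.dir (((G.toModelK κ).L : ℝ) ^ A.k) A.Kb S c A.K) j :=
    sum_attach (choices G.src G.tgt S) fun c => rawE (G.toModelK κ).L (G.toModelK κ).d A.k G.src G.tgt A.box
      (allU G.src A.dir (((G.toModelK κ).L : ℝ) ^ A.k) S c A.u)
      (allK G.src G.tgt A.dir (((G.toModelK κ).L : ℝ) ^ A.k) A.Kb S c A.K) j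
  rw [hsum]
  exact A.E_allSites A.dir A.Kb j S ((sites_isSiteSet G).mono hS)
    (fun l hl x y => A.K_eq l (hS1 l hl).1 (hS1 l hl).2.1 (j l) x y) (fun l hl => A.u_face l (hS1 l hl).1 (hS1 l hl).2.1)

/-! ## The prefactor of a term -/

/-- `Π_v NAc v ≤ cD^m · Π_v NA v`. [cite: Balaban1983Higgs3, (2.9) p.425] -/
theorem prod_NAc_le (A : IBPAmpK₁ G κ) : ∏ v, A.NAc S c v ≤ A.cD ^ m * ∏ v, (A.toAmp : Amp (G.toModelK κ)).NA v := by
  classical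
  have hcD := A.one_le_cD
  have h1 : ∏ v, A.NAc S c v = (∏ v, (if (∃ l ∈ S, G.src l = v ∧ c l = none) then A.cD else 1)) * ∏ v, A.NA v := by
    rw [← prod_mul_distrib]
    refine prod_congr rfl fun v _ => ?_
    unfold NAc
    split_ifs <;> simp
  rw [h1, prod_ite, prod_const_one, mul_one, prod_const]
  refine mul_le_mul_of_nonneg_right ?_ (prod_nonneg fun v _ => A.NA_nonneg v)
  exact pow_le_pow_right₀ hcD (IBPAmp.card_derived_le (G := G) (S := S) (c := c))

/-- **The prefactor of a term is at most `cD^m` times the prefactor of the amplitude.** [cite: Balaban1983Higgs3, (1.33) p.420] -/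
theorem term_prefM_le (A : IBPAmpK₁ G κ) (hS : S ⊆ sites G) (hc : c ∈ choices G.src G.tgt S) :
    (A.term hS hc).prefM ≤ A.cD ^ m * A.toAmp.prefM := by
  show (A.term hS hc).eRun ^ (∑ v, (A.term hS hc).dv v) * (A.term hS hc).lamRun ^ (∑ v, (A.term hS hc).ds v)
      * Real.exp (-(((moveCounts G S c).toModelK κ).δ₀
          * boxTreeLen ((moveCounts G S c).toModelK κ).L (A.term hS hc).k (A.term hS hc).box))
      * (∏ v, (A.term hS hc).NPhi v) * ∏ v, (A.term hS hc).NA v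
    ≤ A.cD ^ m * (A.eRun ^ (∑ v, A.dv v) * A.lamRun ^ (∑ v, A.ds v)
      * Real.exp (-((G.toModelK κ).δ₀ * boxTreeLen (G.toModelK κ).L A.k A.box)) * (∏ v, A.NPhi v) * ∏ v, A.NA v)
  have hk : (A.term hS hc).k = A.k := rfl
  have hbox : (A.term hS hc).box = A.box := rfl
  have hδ : ((moveCounts G S c).toModelK κ).δ₀ = (G.toModelK κ).δ₀ := rfl
  have hL : ((moveCounts G S c).toModelK κ).L = (G.toModelK κ).L := rfl
  rw [hk, hbox, hδ, hL]
  have hmain := A.prod_NAc_le (S := S) (c := c)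
  have h0 : 0 ≤ A.eRun ^ (∑ v, A.dv v) * A.lamRun ^ (∑ v, A.ds v)
      * Real.exp (-((G.toModelK κ).δ₀ * boxTreeLen (G.toModelK κ).L A.k A.box)) * (∏ v, A.NPhi v) := by
    have := A.eRun_nonneg
    have := A.lamRun_nonneg
    have : 0 ≤ ∏ v, A.NPhi v := prod_nonneg fun v _ => A.NPhi_nonneg v
    positivity
  calc A.eRun ^ (∑ v, A.dv v) * A.lamRun ^ (∑ v, A.ds v)
        * Real.exp (-((G.toModelK κ).δ₀ * boxTreeLen (G.toModelK κ).L A.k A.box)) * (∏ v, A.NPhi v) * ∏ v, A.NAc S c v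
      ≤ A.eRun ^ (∑ v, A.dv v) * A.lamRun ^ (∑ v, A.ds v)
        * Real.exp (-((G.toModelK κ).δ₀ * boxTreeLen (G.toModelK κ).L A.k A.box)) * (∏ v, A.NPhi v)
        * (A.cD ^ m * ∏ v, A.NA v) := mul_le_mul_of_nonneg_left hmain h0
    _ = _ := by ring

/-- The product of the term's kernel constants. [cite: Balaban1983Higgs3, (2.13) p.426] -/
theorem term_prod_C (A : IBPAmpK₁ G κ) (hS : S ⊆ sites G) (hc : c ∈ choices G.src G.tgt S) :
    ∏ q, (A.term hS hc).C q = (∏ q, A.C q) * ((1 + Esh (G.toModelK κ)) ^ 2) ^ m := by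
  show ∏ q, A.C q * (1 + Esh (G.toModelK κ)) ^ 2 = _
  rw [prod_mul_distrib, prod_const, card_univ, Fintype.card_fin]

/-! ## Relabeling along an ordering and non-vacuity -/

/-- The print-strength IBP-ready generalized amplitude with its lines renumbered along the ordering l̃ = σ.
[cite: Balaban1983Higgs3, (2.7) p.425] -/
noncomputable def relabel (A : IBPAmpK₁ G κ) (σ : Equiv.Perm (Fin m)) : IBPAmpK₁ (relabelCounts G σ) (κ ∘ σ) where
  toAmp := A.toAmp.relabelK σ
  dir := A.dir
  Kb := fun i => A.Kb (σ i)
  cD := A.cD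
  one_le_cD := A.one_le_cD
  single := fun v i i' hne h1 => A.single v (σ i) (σ i') (fun h => hne (σ.injective h)) h1
  K_eq := fun i hne hd t x y => A.K_eq (σ i) hne hd t x y
  Kb_le := fun i hne hd => A.Kb_le (σ i) hne hd
  u_face := fun i hne hd => A.u_face (σ i) hne hd
  du_le := fun i hne hd x => A.du_le (σ i) hne hd x
  KdX_le := fun i μ h => A.KdX_le (σ i) μ h
  KdY_le := fun i ν h => A.KdY_le (σ i) ν h
  KdXY_le := fun i μ ν hx hy => A.KdXY_le (σ i) μ ν hx hy

/-- Relabeling does not change the prefactor. [cite: Balaban1983Higgs3, (2.7) p.425] -/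
theorem relabel_prefM (A : IBPAmpK₁ G κ) (σ : Equiv.Perm (Fin m)) : (A.relabel σ).toAmp.prefM = A.toAmp.prefM := rfl

/-- The zero amplitude over a connected count datum with one derivative leg per vertex is print-strength IBP-ready for any extra
exponents. [cite: Balaban1983Higgs3, Prop. 2.2 p.428] -/
noncomputable def zero (G : Counts V m) (κ : Fin m → ℚ) (hG : LinesConnect G.src G.tgt)
    (hs : ∀ (v : V) (l l' : Fin m), l ≠ l' → 1 ≤ G.diffOn v l → G.diffOn v l' = 0) (k : ℕ)
    (box : V → Fin (G.toModelK κ).d → ℕ) : IBPAmpK₁ G κ :=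
  (IBPAmpK.zero G κ hG k box).toSingle hs

end IBPAmpK₁

end Ready

end B3Ineq213

end Literature.MathematicalPhysics.QuantumFieldTheory.Balaban1983to89
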